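import Summits.Parity.GeneralizedHardyLittlewood.Theses.GreenTaoLevelTwo
import Literature.NumberTheory.Sieve.LinearEquationsInPrimesGowersCyclic
import Summits.Parity.GeneralizedHardyLittlewood.Theorems.GreenTaoLevelTwoGITwoQuadraticPhaseRung
import Summits.Parity.GeneralizedHardyLittlewood.Theorems.GreenTaoLevelTwoGITwoCyclicToInterval

/-!
# BC3 birth skeleton — crux `GITwo` (rank 2) of route `GreenTaoLevelTwo` (Parity / GeneralizedHardyLittlewood)

FORMALISATION-FIRST of a PRINTED theorem (FRONTIER rung; no new mathematics): `GITwo` = GI(2) on `[N]`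
(GT2010 Conj. 8.3 / Prop. 8.4 datum `GreenTao2010_inverseDatum 2 δ 𝓜 M c`) with inverse families in the
Heisenberg class `𝒞₂(H_d)`, for every Def-8.1 metric `d` that is box-comparable.  Printed proof =
Green–Tao 2008a (PEMS 51 = arXiv:math/0503014):
* `stub_cyclicInverse` (XL, the paper proper, Thm. 12.8 = "Inverse theorem for `U³(ℤ/Nℤ)`, elementary
  nilsequence version": `N'` prime, `f : ℤ/N'ℤ → [−1,1]`, `‖f‖_{U³} ≥ η` ⇒ a shift `h` and an elementary
  2-step nilsequence `F(gⁿ x₀)` (`−N'/2 < n < N'/2`) on a member of the Heisenberg class with Lipschitz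
  constant `M(η, d)` and correlation `≥ c(η, d) > 0`; REAL form; the skew-shift examples are dispensable
  by the Remark after Thm. 12.8, so the family lives in products of `H_d` and circles; Lipschitz constants
  transfer to any box-comparable `d` («all of the functions F used in these constructions are
  2π-Lipschitz», p. 41 of the arXiv text, for the cube coordinates));
* `stub_cyclicToInterval` (L): the passage `[N] ↪ ℤ/N'ℤ` (`N'` prime `∈ (2N, 4N]`, Bertrand; GT2010
  Lemma B.5, tree `compareB5`), absorbing the shift and the wrap-around interval cutoffs into a circle
  factor (the class is closed under `× ℝ/ℤ`), and `δ ↦ η = δ`-type loss bookkeeping (`η⁸ ≤ ‖f‖⁸`).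
Composition `GITwo_of` (modus ponens; BC2(b): the triviality of the join is irrelevant) concludes the
ROUTE decl `Summit.Parity.GeneralizedHardyLittlewood.Theses.GreenTaoLevelTwo.GITwo` by name.
Honours the T1 choice-metric trap: everything is stated over `heisenbergWith d h`, never over
`Nilmanifold.heisenberg`.

Lead revision (leafhand-parity-greentaoleveltwo-1 g0, 2026-08-30): the BC5 rung
`stub_rung_quadraticPhase` is stated with its signature spelled out and is PROVED in the tree
(`Theorems/GreenTaoLevelTwoGITwoQuadraticPhaseRung.lean`, p794372); the two stubs
`stub_cyclicInverse` (XL) and `stub_cyclicToInterval` (L) are registered with their signatures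
SPELLED OUT (`cyclicCorr` unfolded; same propositions definitionally, see the `example`s) so that
Theorems files can land them by name + signature; `stub_cyclicToInterval` IS LANDED
(`Theorems/GreenTaoLevelTwoGITwoCyclicToInterval.lean`, p795643), so the ONLY remaining stub of this
skeleton is the XL `stub_cyclicInverse` (Green–Tao 2008a Thm. 12.8 over the Heisenberg class):
`GITwo` is now PROVED MODULO that one printed theorem.
-/

noncomputable section

namespace Summit.Parity.GeneralizedHardyLittlewood.Cruxes.GITwo.Birth

open Literature.NumberTheory.Sieve
open Literature.NumberTheory.Sieve.GreenTaoLevelTwo (HX IsCompatMetric IsBoxComparable heisenbergWith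
  InHeisClass)

/-- The correlation `𝔼_{n ∈ ℤ/N'ℤ} f(n + h) F(gⁿ x₀)` of GT08a Thm. 12.8, the nilsequence being
"adapted to `ℤ/N'ℤ`" through the representatives `−N'/2 < n < N'/2`. -/
def cyclicCorr {N' : ℕ} (f : ZMod N' → ℝ) (hsh : ZMod N') (X : Nilmanifold 2)
    (F : X.G ⧸ X.Γ → ℝ) (g : X.G) (x₀ : X.G ⧸ X.Γ) : ℝ :=
  (∑ n ∈ Finset.Icc (-((N' : ℤ) / 2)) ((N' : ℤ) / 2),
      f ((n : ZMod N') + hsh) * F (g ^ n • x₀)) / N'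

/-- Stub 1 statement (XL): GT08a Thm. 12.8 over the Heisenberg class of `H_d`, real form. -/
def Signature.stub_cyclicInverse : Prop :=
  ∀ (d : HX → HX → ℝ) (h : IsCompatMetric d), IsBoxComparable d →
    ∀ η : ℝ, 0 < η → η ≤ 1 → ∃ (m : ℕ) (𝓜 : Fin m → Nilmanifold 2) (M c : ℝ),
      (∀ i, InHeisClass (heisenbergWith d h) (𝓜 i)) ∧ 0 < c ∧
        ∀ (N' : ℕ) [NeZero N'], N'.Prime → 2 < N' → ∀ f : ZMod N' → ℝ, (∀ x, |f x| ≤ 1) →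
          η ^ 8 ≤ gowersPower 3 f →
            ∃ (i : Fin m) (g : (𝓜 i).G) (x₀ : (𝓜 i).G ⧸ (𝓜 i).Γ) (hsh : ZMod N')
              (F : (𝓜 i).G ⧸ (𝓜 i).Γ → ℝ),
              (𝓜 i).IsBoundedLipschitz M F ∧ c ≤ |cyclicCorr f hsh (𝓜 i) F g x₀|

/-- Stub 2 statement (L): from `ℤ/N'ℤ` to `[N]`. -/
def Signature.stub_cyclicToInterval : Prop :=
  Signature.stub_cyclicInverse → Summit.Parity.GeneralizedHardyLittlewood.Theses.GreenTaoLevelTwo.GITwo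

/-- Stub 1 (XL), registered with its statement SPELLED OUT (`cyclicCorr` unfolded; definitionally
`Signature.stub_cyclicInverse`, see the `example`s below). -/
theorem stub_cyclicInverse :
    ∀ (d : HX → HX → ℝ) (h : IsCompatMetric d), IsBoxComparable d →
      ∀ η : ℝ, 0 < η → η ≤ 1 → ∃ (m : ℕ) (𝓜 : Fin m → Nilmanifold 2) (M c : ℝ),
        (∀ i, InHeisClass (heisenbergWith d h) (𝓜 i)) ∧ 0 < c ∧
          ∀ (N' : ℕ) [NeZero N'], N'.Prime → 2 < N' → ∀ f : ZMod N' → ℝ, (∀ x, |f x| ≤ 1) →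
            η ^ 8 ≤ gowersPower 3 f →
              ∃ (i : Fin m) (g : (𝓜 i).G) (x₀ : (𝓜 i).G ⧸ (𝓜 i).Γ) (hsh : ZMod N')
                (F : (𝓜 i).G ⧸ (𝓜 i).Γ → ℝ),
                (𝓜 i).IsBoundedLipschitz M F ∧
                  c ≤ |(∑ n ∈ Finset.Icc (-((N' : ℤ) / 2)) ((N' : ℤ) / 2),
                      f ((n : ZMod N') + hsh) * F (g ^ n • x₀)) / N'| := by
  sorry

/-- Stub 2 (L) is no longer a stub: it is PROVED in the tree (p795643) as
`Summit.Parity.GeneralizedHardyLittlewood.GreenTaoLevelTwoGITwoCyclicToInterval.stub_cyclicToInterval`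
(`Theorems/GreenTaoLevelTwoGITwoCyclicToInterval.lean`; helper files `…Prelims`, `…Cutoff`), whose
statement is the plan's `Signature.stub_cyclicToInterval` (definitional): -/
example : Signature.stub_cyclicToInterval :=
  Summit.Parity.GeneralizedHardyLittlewood.GreenTaoLevelTwoGITwoCyclicToInterval.stub_cyclicToInterval

/-- The spelled-out stub is the plan's `Signature.stub_cyclicInverse` (definitional). -/
example : Signature.stub_cyclicInverse := stub_cyclicInverse

/-- **Composition (kernel-checked)**: the one remaining stub gives the route crux BY NAME, through
the LANDED transfer `stub_cyclicToInterval`. -/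
theorem GITwo_of :
    Signature.stub_cyclicInverse →
      Summit.Parity.GeneralizedHardyLittlewood.Theses.GreenTaoLevelTwo.GITwo :=
  fun h1 =>
    Summit.Parity.GeneralizedHardyLittlewood.GreenTaoLevelTwoGITwoCyclicToInterval.stub_cyclicToInterval h1

/-- **The skeleton instantiated**: the crux BY NAME modulo the single registered stub
`stub_cyclicInverse` (carries exactly its `sorry`). -/
theorem GITwo_of_stubs : Summit.Parity.GeneralizedHardyLittlewood.Theses.GreenTaoLevelTwo.GITwo :=
  GITwo_of stub_cyclicInverse

/-! ### BC5 rung (plan-only; the first prover target on this crux if Phase 2 is funded) -/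

/-- **Rung (BC5, plan-only)**: quadratic phases `e(αn² + βn)` on `[N]` are Heisenberg nilsequences
over EVERY box-comparable realisation `(H_d, d)`, quantitatively and uniformly in `N, α, β`: some
`1`-bounded `M`-Lipschitz `F` on `H_d` and an orbit correlate `≥ c` with the phase, `M, c` depending
only on `d` (GT08a §12, the "construct" step of Thm. 12.8).  Outside S's known regime (the tree
realises no quadratic phase as a 2-step nilsequence) and exercises the route's lever (with the
choice metric of `Nilmanifold.heisenberg` no Lipschitz constant is controlled; box-comparability is
exactly what makes `M` uniform).  Technique: explicit coordinates on `Heis`, `heisPreDist`-Lipschitz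
estimates for the cutoff, comparability constant `L` ⇒ `M = O(L)`. -/
def Signature.stub_rung_quadraticPhase : Prop :=
  ∀ (d : HX → HX → ℝ) (h : IsCompatMetric d), IsBoxComparable d →
    ∃ M c : ℝ, 0 < c ∧ ∀ (N : ℕ), 1 ≤ N → ∀ α β : ℝ,
      ∃ (g : (heisenbergWith d h).G) (x₀ : (heisenbergWith d h).G ⧸ (heisenbergWith d h).Γ)
        (F : (heisenbergWith d h).G ⧸ (heisenbergWith d h).Γ → ℝ),
        (heisenbergWith d h).IsBoundedLipschitz M F ∧
          c ≤ ‖(∑ n ∈ Finset.Icc (1 : ℤ) N,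
              Complex.exp (2 * Real.pi * Complex.I * ((α * (n : ℝ) ^ 2 + β * n : ℝ) : ℂ)) *
                (F (g ^ n • x₀) : ℂ)) / (N : ℂ)‖

/-- The BC5 rung, statement SPELLED OUT (definitionally `Signature.stub_rung_quadraticPhase`, see the
`example` below): LANDED by name as
`Summit.Parity.GeneralizedHardyLittlewood.GreenTaoLevelTwoGITwoQuadraticPhaseRung.stub_rung_quadraticPhase`
(p794372, helper lemmas p793884; `M = 8πL`, `c = ½`) — no longer a stub of this skeleton. -/
theorem stub_rung_quadraticPhase :
    ∀ (d : HX → HX → ℝ) (h : IsCompatMetric d), IsBoxComparable d →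
    ∃ M c : ℝ, 0 < c ∧ ∀ (N : ℕ), 1 ≤ N → ∀ α β : ℝ,
      ∃ (g : (heisenbergWith d h).G) (x₀ : (heisenbergWith d h).G ⧸ (heisenbergWith d h).Γ)
        (F : (heisenbergWith d h).G ⧸ (heisenbergWith d h).Γ → ℝ),
        (heisenbergWith d h).IsBoundedLipschitz M F ∧
          c ≤ ‖(∑ n ∈ Finset.Icc (1 : ℤ) N,
              Complex.exp (2 * Real.pi * Complex.I * ((α * (n : ℝ) ^ 2 + β * n : ℝ) : ℂ)) *
                (F (g ^ n • x₀) : ℂ)) / (N : ℂ)‖ :=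
  Summit.Parity.GeneralizedHardyLittlewood.GreenTaoLevelTwoGITwoQuadraticPhaseRung.stub_rung_quadraticPhase

/-- The spelled-out rung stub is the plan's `Signature.stub_rung_quadraticPhase` (definitional). -/
example : Signature.stub_rung_quadraticPhase := stub_rung_quadraticPhase

end Summit.Parity.GeneralizedHardyLittlewood.Cruxes.GITwo.Birth
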